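import Summits.QuantumFields.BalabanUV.T4Continuum.Spine.NE7b.BarePartitionFnDecay

/-!
# BalabanUVNodes ∕ N13 — THE AXIAL-TREE (COMPARISON) UPPER BOUND ON BAŁABAN's FINE-LATTICE WILSON PARTITION FUNCTION: `Z_P(β) ≤ linkMass(β)^{(d−1)(1−1∕n)|T₁^{(0)}|}`

(Track A, DAG node N13 = [B16]; cluster K1 — K1⁹ `StabilityBRunRowsAtRecordR13SepCoPHV` = stmt-QuantumFields-27364, helper; seat `pub-ymgap-dag-n13-w3` g6, CLAIM-1;
2026-08-28; count-neutral.)  The UPPER companion of this seat's g5 LOWER bounds (`…N13WilsonPartitionFnGaugeFixedLowerBound` p635238, `…N13GaugeFixingAxialLayers`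
p639903: `log Z ≥ −(((d−1)+1∕n)(N²−1)∕2)|T| log β − C|T|`).  Here, for ANY regular gauge group `G`, ANY `Params` and `β ≥ 0`:

  `Z_P(β) = ∫ e^{−βA(U)} dU ≤ linkMass(β)^{#𝔉}`,  `#𝔉 = (d−1)·(1 − 1∕n)·|T₁^{(0)}|`,  `n = 2L^{m+K}`,  `linkMass β = ∫_G e^{−β(1 − Re tr V)} dV`

(`NE7b.BarePartitionFnDecay.linkMass`; that file has the same shape for the THIN `x₁ = 0` family, exponent `#famSites`; here the exponent is the FULL transversal Gaussian
count `(d−1)|T|` up to `1∕n`).  With a one-plaquette Laplace bound `linkMass β ≤ C_N β^{−(N²−1)∕2}` on `SU(N)` (dag-n13-w1 g6, separate file): `log Z_P(β) ≤ −((d−1)(N²−1)∕2)(1−1∕n)|T| log β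
+ (d−1)|T| log C_N`; with p639903 `log Z` is then pinned TWO-SIDEDLY to `−((d−1)(N²−1)∕2)|T| log β + O(|T| + |T| log β ∕ n)`.

THE MATHEMATICS ([folklore] comparison with the axial tree; kernel measure theory).  The AXIAL FAMILY in direction `μ₀`: `𝔉 = {p : μ(p) = μ₀ ∧ (src p)_{μ₀} ≠ −1}` (all
plaquettes `⟨x, e_{μ₀}, e_ν⟩`, `μ₀ < ν`, whose source is off the last `μ₀`-layer).  (i) `A(U) ≥ Σ_{p∈𝔉}(1 − Re tr U(∂p))` (every term is `≥ 0`), so `e^{−βA} ≤ ∏_{𝔉} φ_β(U(∂p))`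
(`BarePartitionFnDecay.boltzmann_le_prod`).  (ii) The PIVOT of `p = ⟨x, e_{μ₀}, e_ν⟩` is its ν-bond at `x + e_{μ₀}`; it sits in the middle: `U(∂p) = U⟨x,μ₀⟩·U(piv p)·(U⟨x+e_ν,μ₀⟩⁻¹U⟨x,ν⟩⁻¹)`
(§1); pivots of distinct members are distinct, and the pivot of `q` is a link of another member `p` only if `src p = src q + e_{μ₀}` (one `μ₀`-layer ABOVE `q`).  (iii) Hence the family is
TRIANGULAR: in any sub-family `A ⊆ 𝔉` a member `q` of MAXIMAL layer `(src q)_{μ₀}.val` has a private pivot (no member sits above it — the last layer is excluded, so no wrap), and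
integrating that pivot first (`lmarginal_insert'`) turns `φ_β(a·V·b)` into `linkMass β` by two-sided Haar invariance, leaving the product over `A ∖ {q}`: by induction
`∫⋯∫⁻_{piv(A)} ∏_{p∈A} φ_β(U(∂p)) = linkMassE β ^ #A` (§2), so `Z ≤ linkMass β ^ #𝔉` (§3).  (iv) `#𝔉 = #Ioi(μ₀) · (|T| − |T|∕n)`; at `μ₀ = e₀`: `(d−1)(1−1∕n)|T|` (§4); log form (§5).

CONTENTS (0 `sorry`, 0 `def`): §1 `plaqHol_eq_mul_pivot_mul`, `shift_ne_self`, `shift_injective`, `eq_of_axialPivot_eq`, `plaqHol_update_axialPivot_self ∕ _of_ne`, `val_add_one_of_ne_neg_one`;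
§2 `measurable_prodPlaqFactor`, `lintegral_plaqFactor_mul_mul`, ★★ `lmarginal_prodPlaqFactor_axial_eq_pow`; §3 `lintegral_prodPlaqFactor_axial_le`, ★★★ `partitionFn_le_linkMass_pow_of_axial`;
§4 `card_filter_coord_eq`, `sitesPerDir_mul_card_filter_coord`, `card_axialFamily_eq`, `card_axialFamily_real`, `card_axialFamily_zero_real`; §5 `linkMass_pos`, ★★★ `partitionFn_le_linkMass_pow_axialTree`,
★★★ `log_partitionFn_le_axialTree` (`log Z_P(β) ≤ (d−1)(1−1∕n)|T₁^{(0)}|·log linkMass(β)`), `…_d4`.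
HONEST FRAMING: elementary; nothing of Bałaban's asserted or refuted; no skeleton ∕ route text touched; N13 NOT discharged; K1⁹ NEITHER proved NOR refuted; no stub closed; counts UNMOVED
(typed 28∕28 · discharged 5∕27 · A 5∕28); one finite 𝕋⁴ at fixed ε; R4 closes the conditional finite-𝕋⁴ rung `BalabanLadder.UV` only — the Yang–Mills mass gap (Clay) is NOT proved by any of
this; nothing continuum ∕ ℝ⁴ ∕ OS.  No `sorry`, `def`, `instance`, `notation`.
-/

noncomputable section

open MeasureTheory
open scoped ENNReal BigOperators
namespace Summit.QuantumFields.YangMills.BalabanUVNodes.N13WilsonPartitionFnAxialTreeUpperBound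

open Literature.MathematicalPhysics.QuantumFieldTheory.Balaban1983to89 Literature.MathematicalPhysics.QuantumFieldTheory.Balaban1983to89.Missing
open Summit.QuantumFields.BalabanUV.T4Continuum.NE7b.BarePartitionFnDecay
  (plaqFactor plaqFactor_pos linkMass linkMassE linkMass_nonneg linkMassE_eq_ofReal linkMassE_ne_top
    measurable_plaqFactor integrable_plaqFactor lintegral_plaqFactor_mul_right boltzmann_le_prod one_ne_zero_coord one_lt_sitesPerDir_zero)

variable {G : Type*} [GaugeGroup G] [MeasurableSpace G] [HaarData G]

/-! ## §1. Pivot algebra of the axial plaquettes -/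

section Algebra

variable (P : Params)

omit [MeasurableSpace G] [HaarData G] in
/-- `U(∂p) = U⟨x,μ⟩ · U⟨x+e_μ,ν⟩ · (U⟨x+e_ν,μ⟩⁻¹ · U⟨x,ν⟩⁻¹)`: the ν-bond at `x + e_μ` (the PIVOT of `p`) sits in the middle. [folklore] -/
theorem plaqHol_eq_mul_pivot_mul {j : ℕ} (U : GaugeField P j G) (p : Plaq P j) :
    GaugeField.plaqHol U p = U ⟨p.src, p.μ⟩ * U ⟨p.src.shift p.μ, p.ν⟩ * ((U ⟨p.src.shift p.ν, p.μ⟩)⁻¹ * (U ⟨p.src, p.ν⟩)⁻¹) := by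
  rw [GaugeField.plaqHol, mul_assoc]

/-- `x + e_μ ≠ x` on the finest torus (`(1 : ZMod n) ≠ 0`, `n = 2L^{m+K} > 1`). [folklore] -/
theorem shift_ne_self (x : Site P 0) (μ : Fin P.d) : x.shift μ ≠ x := by
  intro h
  have h1 : x μ + 1 = x μ := by simpa [Site.shift] using congrFun h μ
  exact one_ne_zero_coord P (add_eq_left.mp h1)

/-- `x ↦ x + e_μ` is injective. [folklore] -/
theorem shift_injective {j : ℕ} (μ : Fin P.d) : Function.Injective fun x : Site P j => x.shift μ := by
  intro x y h
  funext κ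
  by_cases hk : κ = μ
  · subst hk; simpa [Site.shift] using congrFun h κ
  · simpa [Site.shift, hk] using congrFun h κ

/-- Two plaquettes with the same first direction and the same pivot coincide. [folklore] -/
theorem eq_of_axialPivot_eq {j : ℕ} {p q : Plaq P j} (hμ : p.μ = q.μ)
    (h : (⟨p.src.shift p.μ, p.ν⟩ : PBond P j) = ⟨q.src.shift q.μ, q.ν⟩) : p = q := by
  have hν : p.ν = q.ν := congrArg PBond.dir h
  have hs : p.src.shift p.μ = q.src.shift q.μ := congrArg PBond.src h
  rw [hμ] at hs
  have hsrc : p.src = q.src := shift_injective P q.μ hs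
  obtain ⟨ps, pμ, pν, ph⟩ := p; obtain ⟨qs, qμ, qν, qh⟩ := q
  simp only at hμ hν hsrc; subst hμ; subst hν; subst hsrc; rfl

variable [DecidableEq (PBond P 0)]

omit [MeasurableSpace G] [HaarData G] in
/-- Replacing the pivot variable of `q` by `V`: `U(∂q)` becomes `U⟨x,μ⟩ · V · (U⟨x+e_ν,μ⟩⁻¹U⟨x,ν⟩⁻¹)` (the three companions of `q` are not its pivot). [folklore] -/
theorem plaqHol_update_axialPivot_self (U : GaugeField P 0 G) (V : G) (q : Plaq P 0) :
    GaugeField.plaqHol (Function.update U ⟨q.src.shift q.μ, q.ν⟩ V) q =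
      U ⟨q.src, q.μ⟩ * V * ((U ⟨q.src.shift q.ν, q.μ⟩)⁻¹ * (U ⟨q.src, q.ν⟩)⁻¹) := by
  have hμν : q.μ ≠ q.ν := Fin.ne_of_lt q.hμν
  have h1 : (⟨q.src, q.μ⟩ : PBond P 0) ≠ ⟨q.src.shift q.μ, q.ν⟩ := fun h => hμν (congrArg PBond.dir h)
  have h2 : (⟨q.src.shift q.ν, q.μ⟩ : PBond P 0) ≠ ⟨q.src.shift q.μ, q.ν⟩ := fun h => hμν (congrArg PBond.dir h)
  have h3 : (⟨q.src, q.ν⟩ : PBond P 0) ≠ ⟨q.src.shift q.μ, q.ν⟩ :=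
    fun h => shift_ne_self P q.src q.μ (congrArg PBond.src h).symm
  rw [plaqHol_eq_mul_pivot_mul, Function.update_self, Function.update_of_ne h1, Function.update_of_ne h2,
    Function.update_of_ne h3]

omit [MeasurableSpace G] [HaarData G] in
/-- … while `U(∂p)` is unchanged for every other plaquette `p` with the same first direction, UNLESS `p` sits one `μ`-layer above `q` with the same second direction
(`src p = src q + e_μ ∧ ν(p) = ν(q)` — then the pivot of `q` is the fourth link of `p`). [folklore] -/
theorem plaqHol_update_axialPivot_of_ne (U : GaugeField P 0 G) (V : G) {p q : Plaq P 0} (hμ : p.μ = q.μ) (hne : p ≠ q)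
    (habove : ¬ (p.src = q.src.shift q.μ ∧ p.ν = q.ν)) :
    GaugeField.plaqHol (Function.update U ⟨q.src.shift q.μ, q.ν⟩ V) p = GaugeField.plaqHol U p := by
  have hμν : q.μ ≠ q.ν := Fin.ne_of_lt q.hμν
  have h1 : (⟨p.src, p.μ⟩ : PBond P 0) ≠ ⟨q.src.shift q.μ, q.ν⟩ := fun h => hμν (hμ.symm.trans (congrArg PBond.dir h))
  have h2 : (⟨p.src.shift p.ν, p.μ⟩ : PBond P 0) ≠ ⟨q.src.shift q.μ, q.ν⟩ := fun h => hμν (hμ.symm.trans (congrArg PBond.dir h))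
  have h3 : (⟨p.src.shift p.μ, p.ν⟩ : PBond P 0) ≠ ⟨q.src.shift q.μ, q.ν⟩ := fun h => hne (eq_of_axialPivot_eq P hμ h)
  have h4 : (⟨p.src, p.ν⟩ : PBond P 0) ≠ ⟨q.src.shift q.μ, q.ν⟩ := fun h => habove ⟨congrArg PBond.src h, congrArg PBond.dir h⟩
  rw [plaqHol_eq_mul_pivot_mul, plaqHol_eq_mul_pivot_mul, Function.update_of_ne h1, Function.update_of_ne h2,
    Function.update_of_ne h3, Function.update_of_ne h4]

omit [DecidableEq (PBond P 0)] in
/-- NO WRAP below the last layer: for `a ≠ −1` in `ZMod n`, `n = 2L^{m+K}`, `(a + 1).val = a.val + 1`. [folklore] -/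
theorem val_add_one_of_ne_neg_one {a : ZMod (P.sitesPerDir 0)} (ha : a ≠ -1) : (a + 1).val = a.val + 1 := by
  haveI : Fact (1 < P.sitesPerDir 0) := ⟨one_lt_sitesPerDir_zero P⟩
  have hn : a.val < P.sitesPerDir 0 := ZMod.val_lt a
  have h1 : (1 : ZMod (P.sitesPerDir 0)).val = 1 := ZMod.val_one _
  rcases Nat.lt_or_ge (a.val + 1) (P.sitesPerDir 0) with hlt | hge
  · rw [ZMod.val_add_of_lt (by rw [h1]; exact hlt), h1]
  · have heq : a.val + (1 : ZMod (P.sitesPerDir 0)).val = P.sitesPerDir 0 := by rw [h1]; omega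
    have h0 : (a + 1).val = 0 := by rw [ZMod.val_add, heq, Nat.mod_self]
    exact absurd (eq_neg_of_add_eq_zero_left ((ZMod.val_eq_zero _).1 h0)) ha

end Algebra

/-! ## §2. Integrating out the pivots: the marginal of the axial product is `linkMassE β ^ #A` -/

section Marginal

variable (P : Params) [RegularGaugeGroup G]

omit [HaarData G] in
/-- The product `∏_{p∈A} ofReal φ_β(U(∂p))` is measurable. [folklore] -/
theorem measurable_prodPlaqFactor (β : ℝ) (A : Finset (Plaq P 0)) :
    Measurable fun U : GaugeField P 0 G => ∏ p ∈ A, ENNReal.ofReal (plaqFactor β (GaugeField.plaqHol U p)) :=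
  Finset.measurable_prod A fun p _ => ((measurable_plaqFactor β).comp (measurable_plaqHol p)).ennreal_ofReal

omit P in
/-- TWO-SIDED HAAR INVARIANCE: `∫ φ_β(a·V·b) dV = linkMassE β` whatever the companions `a`, `b`. [folklore] -/
theorem lintegral_plaqFactor_mul_mul (β : ℝ) (a b : G) :
    ∫⁻ V, ENNReal.ofReal (plaqFactor β (a * V * b)) ∂(HaarData.haar : Measure G) = linkMassE (G := G) β := by
  haveI : (HaarData.haar : Measure G).IsMulLeftInvariant := ⟨HaarData.map_mul_left⟩
  have h1 : ∫⁻ V, ENNReal.ofReal (plaqFactor β (a * V * b)) ∂(HaarData.haar : Measure G) =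
      ∫⁻ V, ENNReal.ofReal (plaqFactor β (V * b)) ∂(HaarData.haar : Measure G) :=
    lintegral_mul_left_eq_self (μ := (HaarData.haar : Measure G)) (fun V => ENNReal.ofReal (plaqFactor β (V * b))) a
  rw [h1]
  exact lintegral_plaqFactor_mul_right β b

variable [DecidableEq (PBond P 0)]

/-- **★★ THE MARGINAL OVER THE PIVOTS OF AN AXIAL SUB-FAMILY IS `linkMassE β ^ #A`.**  For every finset `A` of plaquettes with first direction `μ₀` and source off the
last `μ₀`-layer (`(src p)_{μ₀} ≠ −1`): `∫⋯∫⁻_{piv(A)} ∏_{p∈A} φ_β(U(∂p)) dU_{piv} = linkMassE β ^ #A` identically in the remaining variables.  Proof: peel a member `q` of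
MAXIMAL layer `(src q)_{μ₀}.val` first (`lmarginal_insert'`) — no member of `A` sits above `q` (no wrap by `val_add_one_of_ne_neg_one`), so its pivot is private (§1) and the
pivot integral is `linkMassE β` (`lintegral_plaqFactor_mul_mul`); induction on `#A`. [folklore] -/
theorem lmarginal_prodPlaqFactor_axial_eq_pow (β : ℝ) (μ₀ : Fin P.d) :
    ∀ (n : ℕ) (A : Finset (Plaq P 0)), A.card = n → (∀ p ∈ A, p.μ = μ₀ ∧ p.src μ₀ ≠ -1) →
      (∫⋯∫⁻_(A.image fun p : Plaq P 0 => (⟨p.src.shift p.μ, p.ν⟩ : PBond P 0)),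
          (fun U : GaugeField P 0 G => ∏ p ∈ A, ENNReal.ofReal (plaqFactor β (GaugeField.plaqHol U p)))
            ∂(fun _ : PBond P 0 => (HaarData.haar : Measure G))) =
        fun _ => linkMassE (G := G) β ^ n := by
  classical
  haveI : IsProbabilityMeasure (HaarData.haar (G := G)) := HaarData.isProb
  intro n
  induction n with
  | zero =>
    intro A hA _
    rw [Finset.card_eq_zero] at hA
    subst hA
    ext U
    simp
  | succ n ih =>
    intro A hA hfam
    have hne : A.Nonempty := by rw [← Finset.card_pos, hA]; exact Nat.succ_pos n
    obtain ⟨q, hqA, hqmax⟩ := Finset.exists_max_image A (fun p : Plaq P 0 => (p.src μ₀).val) hne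
    set A' : Finset (Plaq P 0) := A.erase q with hA'def
    have hqA' : q ∉ A' := Finset.notMem_erase q A
    have hAeq : A = insert q A' := (Finset.insert_erase hqA).symm
    have hA'card : A'.card = n := by
      rw [hA'def, Finset.card_erase_of_mem hqA, hA]; omega
    have hfam' : ∀ p ∈ A', p.μ = μ₀ ∧ p.src μ₀ ≠ -1 := fun p hp => hfam p (Finset.mem_of_mem_erase hp)
    obtain ⟨hqμ, hqtop⟩ := hfam q hqA
    -- the pivot of `q` is not a pivot of `A'`
    have hnot : (⟨q.src.shift q.μ, q.ν⟩ : PBond P 0) ∉ A'.image (fun p : Plaq P 0 => (⟨p.src.shift p.μ, p.ν⟩ : PBond P 0)) := by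
      rw [Finset.mem_image]
      rintro ⟨p, hp, hpe⟩
      have hpμ := (hfam' p hp).1
      exact hqA' ((eq_of_axialPivot_eq P (hpμ.trans hqμ.symm) hpe) ▸ hp)
    -- no member of `A'` sits one layer above `q`
    have habove : ∀ p ∈ A', ¬ (p.src = q.src.shift q.μ ∧ p.ν = q.ν) := by
      rintro p hp ⟨hsrc, -⟩
      have hle := hqmax p (Finset.mem_of_mem_erase hp)
      have hval : (p.src μ₀).val = (q.src μ₀).val + 1 := by
        rw [hsrc, hqμ]
        simp only [Site.shift, Function.update_self]
        exact val_add_one_of_ne_neg_one P hqtop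
      omega
    rw [hAeq, Finset.image_insert, lmarginal_insert' _ (measurable_prodPlaqFactor P β _) hnot]
    -- the inner (pivot) integral
    have hinner : (fun U : PBond P 0 → G => ∫⁻ V, (∏ p ∈ insert q A', ENNReal.ofReal (plaqFactor β
        (GaugeField.plaqHol (Function.update U ⟨q.src.shift q.μ, q.ν⟩ V) p))) ∂(HaarData.haar : Measure G)) =
        fun U => linkMassE (G := G) β * ∏ p ∈ A', ENNReal.ofReal (plaqFactor β (GaugeField.plaqHol U p)) := by
      ext U
      have hrew : ∀ V : G, (∏ p ∈ insert q A', ENNReal.ofReal (plaqFactor β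
          (GaugeField.plaqHol (Function.update U ⟨q.src.shift q.μ, q.ν⟩ V) p))) =
          ENNReal.ofReal (plaqFactor β (U ⟨q.src, q.μ⟩ * V * ((U ⟨q.src.shift q.ν, q.μ⟩)⁻¹ * (U ⟨q.src, q.ν⟩)⁻¹))) *
            ∏ p ∈ A', ENNReal.ofReal (plaqFactor β (GaugeField.plaqHol U p)) := by
        intro V
        rw [Finset.prod_insert hqA', plaqHol_update_axialPivot_self P U V q]
        congr 1
        refine Finset.prod_congr rfl fun p hp => ?_
        have hpμ := (hfam' p hp).1
        have hne : p ≠ q := fun h => hqA' (h ▸ hp)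
        rw [plaqHol_update_axialPivot_of_ne P U V (hpμ.trans hqμ.symm) hne (habove p hp)]
      simp_rw [hrew]
      have hmeas : Measurable fun V : G =>
          ENNReal.ofReal (plaqFactor β (U ⟨q.src, q.μ⟩ * V * ((U ⟨q.src.shift q.ν, q.μ⟩)⁻¹ * (U ⟨q.src, q.ν⟩)⁻¹))) :=
        ((measurable_plaqFactor β).comp ((measurable_const.mul measurable_id).mul_const _)).ennreal_ofReal
      rw [lintegral_mul_const _ hmeas, lintegral_plaqFactor_mul_mul, mul_comm]
    rw [hinner]
    ext U
    have hih := congrFun (ih A' hA'card hfam') U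
    simp only [lmarginal] at hih ⊢
    rw [lintegral_const_mul' _ _ (linkMassE_ne_top β), hih, pow_succ, mul_comm]

end Marginal

/-! ## §3. The partition function is at most `linkMass β ^ #A` for every axial sub-family `A` -/

section Assembly

variable (P : Params) [RegularGaugeGroup G]

/-- `∫ ∏_{p∈A} φ_β(U(∂p)) dU ≤ linkMassE β ^ #A` for an axial sub-family `A`: the marginal over the pivots is that constant (§2), the remaining integrations are over
probability measures. [folklore] -/
theorem lintegral_prodPlaqFactor_axial_le [DecidableEq (PBond P 0)] (β : ℝ) (μ₀ : Fin P.d) (A : Finset (Plaq P 0))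
    (hfam : ∀ p ∈ A, p.μ = μ₀ ∧ p.src μ₀ ≠ -1) :
    ∫⁻ U, (∏ p ∈ A, ENNReal.ofReal (plaqFactor β (GaugeField.plaqHol U p))) ∂fieldMeasure P 0 G ≤ linkMassE (G := G) β ^ A.card := by
  haveI : IsProbabilityMeasure (HaarData.haar (G := G)) := HaarData.isProb
  have hconst : (∫⋯∫⁻_(A.image fun p : Plaq P 0 => (⟨p.src.shift p.μ, p.ν⟩ : PBond P 0)),
      (fun _ : GaugeField P 0 G => linkMassE (G := G) β ^ A.card) ∂(fun _ : PBond P 0 => (HaarData.haar : Measure G))) =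
      fun _ => linkMassE (G := G) β ^ A.card := by
    ext U
    simp only [lmarginal, lintegral_const, measure_univ, mul_one]
  have hfg := ((lmarginal_prodPlaqFactor_axial_eq_pow P β μ₀ A.card A rfl hfam).trans hconst.symm).le
  have h := lintegral_le_of_lmarginal_le (μ := fun _ : PBond P 0 => (HaarData.haar : Measure G))
    (A.image fun p : Plaq P 0 => (⟨p.src.shift p.μ, p.ν⟩ : PBond P 0)) (measurable_prodPlaqFactor P β A) measurable_const hfg
  have hpi : fieldMeasure P 0 G = Measure.pi fun _ : PBond P 0 => (HaarData.haar : Measure G) := rfl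
  rw [hpi]
  refine h.trans (le_of_eq ?_)
  rw [lintegral_const, measure_univ, mul_one]

/-- **★★★ `Z_P(β) ≤ linkMass(β) ^ #A`** for `β ≥ 0` and EVERY axial sub-family `A` (first direction `μ₀`, sources off the last `μ₀`-layer), on any regular gauge group:
drop the other plaquettes (`boltzmann_le_prod`) and integrate the pivots (§2). [folklore] -/
theorem partitionFn_le_linkMass_pow_of_axial {β : ℝ} (hβ : 0 ≤ β) (μ₀ : Fin P.d) (A : Finset (Plaq P 0))
    (hfam : ∀ p ∈ A, p.μ = μ₀ ∧ p.src μ₀ ≠ -1) :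
    partitionFn (G := G) P β ≤ linkMass (G := G) β ^ A.card := by
  classical
  have hint := integrable_boltzmann (G := G) RegularGaugeGroup.measurable_reTr P hβ
  have h1 : ENNReal.ofReal (partitionFn (G := G) P β) = ∫⁻ U, ENNReal.ofReal (boltzmann P β U) ∂fieldMeasure P 0 G :=
    ofReal_integral_eq_lintegral_ofReal hint (Filter.Eventually.of_forall fun U => (boltzmann_pos P β U).le)
  have h2 : ∫⁻ U, ENNReal.ofReal (boltzmann P β U) ∂fieldMeasure P 0 G ≤ linkMassE (G := G) β ^ A.card := by
    refine le_trans (lintegral_mono fun U => ?_) (lintegral_prodPlaqFactor_axial_le P β μ₀ A hfam)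
    calc ENNReal.ofReal (boltzmann P β U)
        ≤ ENNReal.ofReal (∏ p ∈ A, plaqFactor β (GaugeField.plaqHol U p)) := ENNReal.ofReal_le_ofReal (boltzmann_le_prod P hβ A U)
      _ = ∏ p ∈ A, ENNReal.ofReal (plaqFactor β (GaugeField.plaqHol U p)) :=
          ENNReal.ofReal_prod_of_nonneg fun p _ => (plaqFactor_pos β _).le
  have h3 : ENNReal.ofReal (partitionFn (G := G) P β) ≤ ENNReal.ofReal (linkMass (G := G) β ^ A.card) := by
    rw [h1, ENNReal.ofReal_pow (linkMass_nonneg β), ← linkMassE_eq_ofReal]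
    exact h2
  exact (ENNReal.ofReal_le_ofReal_iff (pow_nonneg (linkMass_nonneg β) _)).mp h3

end Assembly

/-! ## §4. The axial family and its cardinality `#𝔉 = #Ioi(μ₀) · (1 − 1∕n) · |T₁^{(0)}|` -/

section Count

variable (P : Params)

/-- All `μ₀`-coordinate classes of sites have the same cardinality (translation in direction `μ₀`). [folklore] -/
theorem card_filter_coord_eq (μ₀ : Fin P.d) (c c' : ZMod (P.sitesPerDir 0)) :
    (Finset.univ.filter fun x : Site P 0 => x μ₀ = c).card = (Finset.univ.filter fun x : Site P 0 => x μ₀ = c').card := by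
  refine Finset.card_bij' (fun x _ => Function.update x μ₀ (x μ₀ + (c' - c))) (fun x _ => Function.update x μ₀ (x μ₀ + (c - c')))
    ?_ ?_ ?_ ?_
  · intro x hx
    refine Finset.mem_filter.2 ⟨Finset.mem_univ _, ?_⟩
    rw [Function.update_self, (Finset.mem_filter.1 hx).2]; ring
  · intro x hx
    refine Finset.mem_filter.2 ⟨Finset.mem_univ _, ?_⟩
    rw [Function.update_self, (Finset.mem_filter.1 hx).2]; ring
  · intro x _
    rw [Function.update_idem, Function.update_self, show x μ₀ + (c' - c) + (c - c') = x μ₀ by ring, Function.update_eq_self]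
  · intro x _
    rw [Function.update_idem, Function.update_self, show x μ₀ + (c - c') + (c' - c) = x μ₀ by ring, Function.update_eq_self]

/-- `n · #{x : x_{μ₀} = c} = |T₁^{(0)}|`, `n = 2L^{m+K}` (the classes partition the torus). [folklore] -/
theorem sitesPerDir_mul_card_filter_coord (μ₀ : Fin P.d) (c : ZMod (P.sitesPerDir 0)) :
    P.sitesPerDir 0 * (Finset.univ.filter fun x : Site P 0 => x μ₀ = c).card = Fintype.card (Site P 0) := by
  classical
  have h := Finset.card_eq_sum_card_fiberwise (f := fun x : Site P 0 => x μ₀) (s := Finset.univ)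
    (t := (Finset.univ : Finset (ZMod (P.sitesPerDir 0)))) (fun x _ => Finset.mem_coe.2 (Finset.mem_univ _))
  rw [← Finset.card_univ, h, Finset.sum_congr rfl fun b _ => card_filter_coord_eq P μ₀ b c, Finset.sum_const, Finset.card_univ,
    ZMod.card, smul_eq_mul]

/-- **THE CARDINALITY OF THE AXIAL FAMILY**: `#{p : μ(p) = μ₀ ∧ (src p)_{μ₀} ≠ −1} = #Ioi(μ₀) · #{x : x_{μ₀} ≠ −1}` (the bijection `p ↦ (src p, ν(p))`). [folklore] -/
theorem card_axialFamily_eq (μ₀ : Fin P.d) :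
    (Finset.univ.filter fun p : Plaq P 0 => p.μ = μ₀ ∧ p.src μ₀ ≠ -1).card =
      (Finset.univ.filter fun x : Site P 0 => x μ₀ ≠ -1).card * (Finset.Ioi μ₀).card := by
  rw [← Finset.card_product]
  refine Finset.card_bij' (fun p _ => (p.src, p.ν)) (fun a ha => ⟨a.1, μ₀, a.2, Finset.mem_Ioi.1 (Finset.mem_product.1 ha).2⟩)
    ?_ ?_ ?_ ?_
  · intro p hp
    obtain ⟨hμ, hs⟩ := (Finset.mem_filter.1 hp).2
    refine Finset.mem_product.2 ⟨Finset.mem_filter.2 ⟨Finset.mem_univ _, hs⟩, Finset.mem_Ioi.2 ?_⟩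
    rw [← hμ]; exact p.hμν
  · intro a ha
    exact Finset.mem_filter.2 ⟨Finset.mem_univ _, rfl, (Finset.mem_filter.1 (Finset.mem_product.1 ha).1).2⟩
  · intro p hp
    obtain ⟨hμ, -⟩ := (Finset.mem_filter.1 hp).2
    obtain ⟨ps, pμ, pν, ph⟩ := p
    simp only at hμ
    subst hμ; rfl
  · intro a _
    rfl

/-- **REAL FORM**: `#𝔉 = #Ioi(μ₀) · |T₁^{(0)}| · (1 − 1∕n)`. [folklore] -/
theorem card_axialFamily_real (μ₀ : Fin P.d) :
    ((Finset.univ.filter fun p : Plaq P 0 => p.μ = μ₀ ∧ p.src μ₀ ≠ -1).card : ℝ) =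
      ((Finset.Ioi μ₀).card : ℝ) * (Fintype.card (Site P 0) : ℝ) * (1 - 1 / (P.sitesPerDir 0 : ℝ)) := by
  classical
  have hn : (0 : ℝ) < (P.sitesPerDir 0 : ℝ) := by exact_mod_cast Nat.pos_of_ne_zero (P.sitesPerDir_ne_zero 0)
  have hfib := sitesPerDir_mul_card_filter_coord P μ₀ (-1)
  have hsplit := Finset.card_filter_add_card_filter_not (s := (Finset.univ : Finset (Site P 0))) (fun x : Site P 0 => x μ₀ = -1)
  have hfibR : (P.sitesPerDir 0 : ℝ) * ((Finset.univ.filter fun x : Site P 0 => x μ₀ = -1).card : ℝ) = (Fintype.card (Site P 0) : ℝ) := by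
    exact_mod_cast hfib
  have hsplitR : ((Finset.univ.filter fun x : Site P 0 => x μ₀ = -1).card : ℝ) + ((Finset.univ.filter fun x : Site P 0 => ¬ x μ₀ = -1).card : ℝ) =
      (Fintype.card (Site P 0) : ℝ) := by
    rw [← Finset.card_univ]; exact_mod_cast hsplit
  rw [card_axialFamily_eq, Nat.cast_mul]
  have h1 : ((Finset.univ.filter fun x : Site P 0 => x μ₀ = -1).card : ℝ) = (Fintype.card (Site P 0) : ℝ) / (P.sitesPerDir 0 : ℝ) := by
    rw [eq_div_iff hn.ne', mul_comm]; exact hfibR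
  have h2 : ((Finset.univ.filter fun x : Site P 0 => x μ₀ ≠ -1).card : ℝ) =
      (Fintype.card (Site P 0) : ℝ) - (Fintype.card (Site P 0) : ℝ) / (P.sitesPerDir 0 : ℝ) := by linarith
  rw [h2]; field_simp

/-- **AT `μ₀ = e₀`**: `#𝔉 = (d − 1) · |T₁^{(0)}| · (1 − 1∕n)` — the full transversal Gaussian count up to `1∕n`. [folklore] -/
theorem card_axialFamily_zero_real :
    ((Finset.univ.filter fun p : Plaq P 0 => p.μ = ⟨0, P.hd⟩ ∧ p.src ⟨0, P.hd⟩ ≠ -1).card : ℝ) =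
      ((P.d : ℝ) - 1) * (Fintype.card (Site P 0) : ℝ) * (1 - 1 / (P.sitesPerDir 0 : ℝ)) := by
  rw [card_axialFamily_real, Fin.card_Ioi]
  have hd : 1 ≤ P.d := P.hd
  have : ((P.d - 1 - (⟨0, P.hd⟩ : Fin P.d) : ℕ) : ℝ) = (P.d : ℝ) - 1 := by
    rw [show ((⟨0, P.hd⟩ : Fin P.d) : ℕ) = 0 from rfl, Nat.sub_zero, Nat.cast_sub hd, Nat.cast_one]
  rw [this]

end Count

/-! ## §5. The axial-tree upper bound on `Z` and its logarithmic form -/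

section Final

variable (P : Params) [RegularGaugeGroup G]

omit P in
/-- `linkMass β > 0` (the integrand is `≥ e^{−2|β|} > 0` and Haar is a probability measure). [folklore] -/
theorem linkMass_pos (β : ℝ) : 0 < linkMass (G := G) β := by
  haveI : IsProbabilityMeasure (HaarData.haar (G := G)) := HaarData.isProb
  have hs : Function.support (plaqFactor (G := G) β) = Set.univ := Set.eq_univ_of_forall fun V => (plaqFactor_pos β V).ne'
  rw [linkMass, integral_pos_iff_support_of_nonneg (fun V => (plaqFactor_pos β V).le) (integrable_plaqFactor β), hs, measure_univ]
  exact one_pos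

/-- **★★★ THE AXIAL-TREE UPPER BOUND**: for every `Params` `P`, every regular gauge group and `β ≥ 0`,
`Z_P(β) ≤ linkMass(β) ^ #𝔉` with `𝔉 = {p : μ(p) = e₀ ∧ (src p)₀ ≠ −1}` the axial family, `#𝔉 = (d−1)(1−1∕n)|T₁^{(0)}|` (`card_axialFamily_zero_real`). [folklore] -/
theorem partitionFn_le_linkMass_pow_axialTree {β : ℝ} (hβ : 0 ≤ β) :
    partitionFn (G := G) P β ≤
      linkMass (G := G) β ^ (Finset.univ.filter fun p : Plaq P 0 => p.μ = ⟨0, P.hd⟩ ∧ p.src ⟨0, P.hd⟩ ≠ -1).card :=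
  partitionFn_le_linkMass_pow_of_axial P hβ ⟨0, P.hd⟩ _ fun _ hp => (Finset.mem_filter.1 hp).2

/-- **★★★ LOGARITHMIC FORM**: `log Z_P(β) ≤ (d − 1)·(1 − 1∕n)·|T₁^{(0)}|·log linkMass(β)` for `β ≥ 0` (`log linkMass β ≤ 0`; with a one-plaquette Laplace bound
`log linkMass β ≤ −((N²−1)∕2) log β + c_N` on `SU(N)` this is the Gaussian upper bound `−((d−1)(N²−1)∕2)(1−1∕n)|T| log β + (d−1)c_N|T|`). [folklore] -/
theorem log_partitionFn_le_axialTree {β : ℝ} (hβ : 0 ≤ β) :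
    Real.log (partitionFn (G := G) P β) ≤
      ((P.d : ℝ) - 1) * (Fintype.card (Site P 0) : ℝ) * (1 - 1 / (P.sitesPerDir 0 : ℝ)) * Real.log (linkMass (G := G) β) := by
  have hZ : 0 < partitionFn (G := G) P β := partitionFn_pos' P hβ
  have h := Real.log_le_log hZ (partitionFn_le_linkMass_pow_axialTree P hβ)
  rw [Real.log_pow, card_axialFamily_zero_real] at h
  exact h

/-- **`d = 4`**: `log Z_P(β) ≤ 3·(1 − 1∕n)·|T₁^{(0)}|·log linkMass(β)`. [folklore] -/
theorem log_partitionFn_le_axialTree_d4 (hd : P.d = 4) {β : ℝ} (hβ : 0 ≤ β) :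
    Real.log (partitionFn (G := G) P β) ≤ 3 * (Fintype.card (Site P 0) : ℝ) * (1 - 1 / (P.sitesPerDir 0 : ℝ)) * Real.log (linkMass (G := G) β) := by
  have h := log_partitionFn_le_axialTree P (G := G) hβ
  have hd4 : (P.d : ℝ) - 1 = 3 := by rw [show (P.d : ℝ) = 4 by exact_mod_cast hd]; norm_num
  rwa [hd4] at h

end Final

end Summit.QuantumFields.YangMills.BalabanUVNodes.N13WilsonPartitionFnAxialTreeUpperBound

end
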